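import Mathlib.NumberTheory.DirichletCharacter.Basic
import Mathlib.Data.ZMod.Units
import HarnessLib

/-!
# The product of primitive Dirichlet characters with coprime conductors is primitive

Topic `Literature/NumberTheory/LFunctions`; namespace `Literature.NumberTheory.LFunctions`.
THEOREMS ONLY (no definition, no named fact).

For Dirichlet characters `ψ` modulo `u` and `φ` modulo `v` with `gcd(u, v) = 1`, both primitive,
the product `ψ φ` read modulo `uv` (`changeLevel ψ * changeLevel φ`) is primitive
(`isPrimitive_changeLevel_mul_changeLevel`): conductors are multiplicative over coprime moduli
(Apostol, Ch. 8; Washington, Ch. 3).  Proof: if the product factors through `d ∣ uv`, then for a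
unit `x` modulo `u` with `x ≡ 1 (mod gcd(d, u))` the unit `y ≡ (x, 1)` modulo `uv` (Chinese
remainder theorem) is `≡ 1 (mod d)`, so `ψ(x) = (ψφ)(y) = 1`: `ψ` factors through `gcd(d, u)`,
whence `u ∣ d` by primitivity; symmetrically `v ∣ d`, so `d = uv`.

## References

* T. M. Apostol, *Introduction to Analytic Number Theory*, Springer UTM (1976), Ch. 8 (induced
  moduli and conductors). [Apostol1976]
* L. C. Washington, *Introduction to Cyclotomic Fields*, 2nd ed., GTM 83 (1997), Ch. 3.
  [Washington1997]
-/

namespace Literature.NumberTheory.LFunctions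

open DirichletCharacter

variable {R : Type*} [CommMonoidWithZero R] {u v : ℕ} [NeZero u] [NeZero v]

omit [NeZero u] [NeZero v] in
/-- **Chinese remainder for units**: given units `a` modulo `u` and `b` modulo `v` with
`gcd(u, v) = 1`, there is a unit `y` modulo `uv` with `y ≡ a (mod u)` and `y ≡ b (mod v)`.
[folklore] -/
theorem exists_unit_unitsMap_eq (huv : u.Coprime v) (a : (ZMod u)ˣ) (b : (ZMod v)ˣ) :
    ∃ y : (ZMod (u * v))ˣ, ZMod.unitsMap (dvd_mul_right u v) y = a ∧
      ZMod.unitsMap (dvd_mul_left v u) y = b := by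
  set e := ZMod.chineseRemainder huv with he
  set y₀ : ZMod (u * v) := e.symm ((a : ZMod u), (b : ZMod v)) with hy₀
  have hy : e y₀ = ((a : ZMod u), (b : ZMod v)) := by rw [hy₀, RingEquiv.apply_symm_apply]
  have hcomp : ∀ z : ZMod (u * v), e z = (ZMod.castHom (dvd_mul_right u v) (ZMod u) z,
      ZMod.castHom (dvd_mul_left v u) (ZMod v) z) := by
    intro z
    obtain ⟨Z, rfl⟩ := ZMod.intCast_surjective z
    rw [map_intCast, map_intCast, map_intCast]
    rfl
  rw [hcomp] at hy
  have h1 : ZMod.castHom (dvd_mul_right u v) (ZMod u) y₀ = a := (Prod.ext_iff.mp hy).1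
  have h2 : ZMod.castHom (dvd_mul_left v u) (ZMod v) y₀ = b := (Prod.ext_iff.mp hy).2
  have hyu : IsUnit y₀ := by
    have hpair : IsUnit (((a : ZMod u), (b : ZMod v)) : ZMod u × ZMod v) :=
      Prod.isUnit_iff.mpr ⟨a.isUnit, b.isUnit⟩
    exact hpair.map e.symm
  refine ⟨hyu.unit, Units.ext ?_, Units.ext ?_⟩
  · rw [ZMod.unitsMap_val, IsUnit.unit_spec]
    exact h1
  · rw [ZMod.unitsMap_val, IsUnit.unit_spec]
    exact h2

omit [NeZero u] in
/-- If `y ≡ 1` modulo `d₁ ∣ u`-part and modulo `d₂`, with `gcd(d₁, d₂) = 1` and `d ∣ d₁ d₂`, then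
`y ≡ 1 (mod d)` (all read from a common level `n`). [folklore] -/
theorem unitsMap_eq_one_of_dvd_mul {n d d₁ d₂ : ℕ} [NeZero n] (hd : d ∣ n) (hd₁ : d₁ ∣ n)
    (hd₂ : d₂ ∣ n) (hcop : d₁.Coprime d₂) (hdd : d ∣ d₁ * d₂) (y : (ZMod n)ˣ)
    (h₁ : ZMod.unitsMap hd₁ y = 1) (h₂ : ZMod.unitsMap hd₂ y = 1) : ZMod.unitsMap hd y = 1 := by
  obtain ⟨Y, hY⟩ := ZMod.intCast_surjective (y : ZMod n)
  have hcast : ∀ {m : ℕ} (hm : m ∣ n), ((ZMod.unitsMap hm y : (ZMod m)ˣ) : ZMod m) = (Y : ZMod m) := by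
    intro m hm
    rw [ZMod.unitsMap_val, ← hY, ZMod.cast_intCast hm]
  have hdvd : ∀ {m : ℕ} (hm : m ∣ n), ZMod.unitsMap hm y = 1 → (m : ℤ) ∣ Y - 1 := by
    intro m hm h
    have : ((Y - 1 : ℤ) : ZMod m) = 0 := by
      push_cast
      rw [← hcast hm, h, Units.val_one, sub_self]
    exact (ZMod.intCast_zmod_eq_zero_iff_dvd _ m).mp this
  have h12 : ((d₁ * d₂ : ℕ) : ℤ) ∣ Y - 1 := by
    push_cast
    exact (Nat.isCoprime_iff_coprime.mpr hcop).mul_dvd (hdvd hd₁ h₁) (hdvd hd₂ h₂)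
  have hdY : (d : ℤ) ∣ Y - 1 := (Int.natCast_dvd_natCast.mpr hdd).trans h12
  apply Units.ext
  rw [hcast hd, Units.val_one]
  have : ((Y - 1 : ℤ) : ZMod d) = 0 := (ZMod.intCast_zmod_eq_zero_iff_dvd _ d).mpr hdY
  push_cast at this
  exact sub_eq_zero.mp this

/-- **Primitivity of a product of primitive characters with coprime conductors.**
[cite: Apostol1976, Ch. 8] -/
theorem isPrimitive_changeLevel_mul_changeLevel (huv : u.Coprime v) {ψ : DirichletCharacter R u}
    {φ : DirichletCharacter R v} (hψ : ψ.IsPrimitive) (hφ : φ.IsPrimitive) :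
    (changeLevel (dvd_mul_right u v) ψ * changeLevel (dvd_mul_left v u) φ).IsPrimitive := by
  haveI : NeZero (u * v) := ⟨mul_ne_zero (NeZero.ne u) (NeZero.ne v)⟩
  set Λ := changeLevel (dvd_mul_right u v) ψ * changeLevel (dvd_mul_left v u) φ with hΛ
  set d := Λ.conductor with hd_def
  have hd : d ∣ u * v := conductor_dvd_level Λ
  have hfac : Λ.FactorsThrough d := factorsThrough_conductor Λ
  have hker := (factorsThrough_iff_ker_unitsMap hd).mp hfac
  -- evaluation of `Λ` on units
  have hΛu : ∀ y : (ZMod (u * v))ˣ, Λ y = ψ (ZMod.unitsMap (dvd_mul_right u v) y) *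
      φ (ZMod.unitsMap (dvd_mul_left v u) y) := by
    intro y
    rw [hΛ, MulChar.mul_apply, changeLevel_def, changeLevel_def]
    simp [MulChar.ofUnitHom_eq]
  have hcop12 : (d.gcd u).Coprime (d.gcd v) :=
    (huv.coprime_dvd_left (Nat.gcd_dvd_right d u)).coprime_dvd_right (Nat.gcd_dvd_right d v)
  have hdd : d ∣ d.gcd u * d.gcd v := by
    rw [← huv.gcd_mul d]
    exact Nat.dvd_gcd dvd_rfl hd
  -- `u ∣ d`
  have hu : u ∣ d := by
    have h1 : ψ.FactorsThrough (d.gcd u) := by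
      rw [factorsThrough_iff_ker_unitsMap (Nat.gcd_dvd_right d u)]
      intro x hx
      rw [MonoidHom.mem_ker] at hx ⊢
      obtain ⟨y, hyx, hy1⟩ := exists_unit_unitsMap_eq huv x 1
      have hyd : ZMod.unitsMap hd y = 1 := by
        refine unitsMap_eq_one_of_dvd_mul hd ((Nat.gcd_dvd_right d u).trans (dvd_mul_right u v))
          ((Nat.gcd_dvd_right d v).trans (dvd_mul_left v u)) hcop12 hdd y ?_ ?_
        · rw [← ZMod.unitsMap_comp (Nat.gcd_dvd_right d u) (dvd_mul_right u v),
            MonoidHom.comp_apply, hyx, hx]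
        · rw [← ZMod.unitsMap_comp (Nat.gcd_dvd_right d v) (dvd_mul_left v u),
            MonoidHom.comp_apply, hy1, map_one]
      have hΛy : Λ.toUnitHom y = 1 := by
        have := hker (show y ∈ (ZMod.unitsMap hd).ker by rwa [MonoidHom.mem_ker])
        rwa [MonoidHom.mem_ker] at this
      have hval := hΛu y
      rw [hyx, hy1, Units.val_one, map_one, mul_one] at hval
      apply Units.ext
      rw [MulChar.coe_toUnitHom, Units.val_one, ← hval, ← MulChar.coe_toUnitHom, hΛy, Units.val_one]
    have h2 := conductor_dvd_of_mem_conductorSet ψ ((mem_conductorSet_iff ψ).mpr h1)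
    rw [(isPrimitive_def ψ).mp hψ] at h2
    exact h2.trans (Nat.gcd_dvd_left d u)
  -- `v ∣ d`
  have hv : v ∣ d := by
    have h1 : φ.FactorsThrough (d.gcd v) := by
      rw [factorsThrough_iff_ker_unitsMap (Nat.gcd_dvd_right d v)]
      intro x hx
      rw [MonoidHom.mem_ker] at hx ⊢
      obtain ⟨y, hy1, hyx⟩ := exists_unit_unitsMap_eq huv 1 x
      have hyd : ZMod.unitsMap hd y = 1 := by
        refine unitsMap_eq_one_of_dvd_mul hd ((Nat.gcd_dvd_right d u).trans (dvd_mul_right u v))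
          ((Nat.gcd_dvd_right d v).trans (dvd_mul_left v u)) hcop12 hdd y ?_ ?_
        · rw [← ZMod.unitsMap_comp (Nat.gcd_dvd_right d u) (dvd_mul_right u v),
            MonoidHom.comp_apply, hy1, map_one]
        · rw [← ZMod.unitsMap_comp (Nat.gcd_dvd_right d v) (dvd_mul_left v u),
            MonoidHom.comp_apply, hyx, hx]
      have hΛy : Λ.toUnitHom y = 1 := by
        have := hker (show y ∈ (ZMod.unitsMap hd).ker by rwa [MonoidHom.mem_ker])
        rwa [MonoidHom.mem_ker] at this
      have hval := hΛu y
      rw [hyx, hy1, Units.val_one, map_one, one_mul] at hval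
      apply Units.ext
      rw [MulChar.coe_toUnitHom, Units.val_one, ← hval, ← MulChar.coe_toUnitHom, hΛy, Units.val_one]
    have h2 := conductor_dvd_of_mem_conductorSet φ ((mem_conductorSet_iff φ).mpr h1)
    rw [(isPrimitive_def φ).mp hφ] at h2
    exact h2.trans (Nat.gcd_dvd_left d v)
  exact (isPrimitive_def Λ).mpr (Nat.dvd_antisymm hd (huv.mul_dvd_of_dvd_of_dvd hu hv))

end Literature.NumberTheory.LFunctions
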